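/-
Copyright (c) 2026 the pub-hodgecm-mathlib formalisation cell (harness21).  Prover seat hodgecm-mathlib-K2E4-p01 (g3), Track B ∕ K2-LIT,
h413 = `stmt-HodgeConjecture-24833`; #22S road, F-B re-cut (RK2_v) (K2E4-plan (g2) RE-DEAL 01:03:11Z; report 01:2xZ): FILE N = the deepest shell of the
ramified ray and the COHERENT-POSITIVITY criterion for non-vanishing canonical orbital integrals.  2026-09-04.
-/
import Summits.HodgeConjecture.HodgeConjecture.Theorems.K2E3GLTwoCentralGermRamifiedRay   -- ★ FILES E W M (this seat) and lineage g2's A B1 B2 C1 C2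
import HarnessLib

/-!
# h413 ∕ Track B «K2-LIT» — FILE N: the DEEPEST SHELL `y_n = X_n (γ_n, c) X_n⁻¹ → (z·η, c)`, `η = (1 0; 1 1)`, of the ramified ray, and the
# COHERENT-POSITIVITY criterion «a phase-coherent test function charging the deepest shells has non-zero canonical orbital integrals along the ray»

Cell `pub/hodgecm-mathlib`, crux H413 = `stmt-HodgeConjecture-24833` (supports-only).  Socket #22S reads, besides (GS_v′) (★ p856291), the rank-two
hypothesis `hRK` of ★ p855314 `weakMatrixFiniteTransport_of_germStructure`: two EXPLICIT `Δ‴_v`-transfer pairs with linearly independent germ pairs along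
the (GS) ray.  The second pair is `f₂ = 1_{e′⁻¹(y_G·K(ϖ^N))}` whose transfer VANISHES at the centre but CHARGES the deepest shells `y_n` of the ray; this file
supplies the two `P`-side facts behind that (`P = GL₂(F) × GL₁(F)`, notation of ★ FILES E∕M):

* §1 `coe_deepShell`, **`tendsto_deepShell`** — `y_n := (r_n⁻¹ γ_n r_n, c) = (z, z v ϖ^{2n}; z, z + zϖⁿu)` is conjugate to `(γ_n, c)` and converges to
  `(z·η, c)`, `η = (1 0; 1 1)` (the regular-unipotent direction: `(z·η)⁻¹ y_n ∈ K(ϖⁿ)`).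
* §2 **`eventually_orbitalIntegral_ne_zero_of_coherent`** — if `ψ ∈ C_c^∞(P)` is PHASE-COHERENT on each class of the ray (`ψ = c_n · (ℝ≥0)` on the
  conjugates of `(γ_n, c)`, `c_n ≠ 0`) and charges the deepest shells (`ψ(k y_n k⁻¹) ≠ 0` for `k ∈ K_P`, `n ≥ N`), then `O_{(γ_n,c)}^{ν∕ρ}(ψ) ≠ 0` for all
  `n ≫ 0` and every normalised `ρ`: the shell sum of ★ FILE E (finite `K_P`-average, ★ FILE M §1) is `c_n` times a sum of non-negative reals whose `r = n`
  term is positive.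

HONEST LABEL: HC_CM is proved only modulo the 7 printed citations (2 remaining named inputs: hLiu418 = `stmt-HodgeConjecture-24832`,
h413 = `stmt-HodgeConjecture-24833`) until rung 0 closes; this file is an unconditional local computation and moves no counter by itself.

## References
* [LabesseLanglands1979] J.-P. Labesse, R. P. Langlands, *L-indistinguishability for SL(2)*, Canad. J. Math. 31 (1979), §2 pp. 7–9.
* [Rogawski1990] J. D. Rogawski, *Automorphic Representations of Unitary Groups in Three Variables* (1990), §8.1 pp. 114–116; §4.9 p. 54.
* [HarishChandra1999AdmissibleDistributions] Harish-Chandra (DeBacker–Sally), *Admissible Invariant Distributions on Reductive p-adic Groups* (1999), Thm. 3.1.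
-/

set_option autoImplicit false
set_option linter.dupNamespace false

noncomputable section

open scoped ValuativeRel Matrix MatrixGroups ENNReal
open Matrix ValuativeRel MeasureTheory Measure Topology Filter
open Literature.MeasureTheory.Group Literature.NumberTheory.Automorphic Literature.NumberTheory.Automorphic.HermitianLatticeTree
open Literature.NumberTheory.Rogawski1990 (IsLocSmooth)
open Summit.HodgeConjecture.HodgeConjecture.Cruxes.H413.K2E3GLTwoRamifiedShellShift
open Summit.HodgeConjecture.HodgeConjecture.Cruxes.H413.K2E3GLTwoRamifiedShellStabilizers
open Summit.HodgeConjecture.HodgeConjecture.Cruxes.H413.K2E3GLTwoRamifiedShellUnfolding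
open Summit.HodgeConjecture.HodgeConjecture.Cruxes.H413.K2E3GLTwoRamifiedTorusCompactCore
open Summit.HodgeConjecture.HodgeConjecture.Cruxes.H413.K2E3GLTwoRamifiedRayGermEngine
open Summit.HodgeConjecture.HodgeConjecture.Cruxes.H413.K2E3GLTwoCentralGermRamifiedRay

namespace Summit.HodgeConjecture.HodgeConjecture.Cruxes.H413.K2E3GLTwoRamifiedRayUnipotentShell

variable {F : Type*} [Field F] [ValuativeRel F] {ϖ : F} (hϖ : IsUniformizingElement ϖ)

/-! ## §1 The deepest shell `y_n = X_n (γ_n, c) X_n⁻¹` and its limit `(z·η, c)` -/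

section Shell

include hϖ in
/-- **The deepest shell conjugate**: `r_n⁻¹ γ_n r_n = (z, z v ϖ^{2n}; z, z + z ϖⁿ u)` (★ `coe_inv_mul_torus_mul_of_coe_eq_diagonal` at `b = zϖⁿ`, `c = ϖⁿ`).
[cite: LabesseLanglands1979, §2 (2.1) p. 8] -/
theorem coe_deepShell {u v : F} (z : F)
    {γ : ℕ → GL (Fin 2) F} (hγ : ∀ n, (γ n : Matrix (Fin 2) (Fin 2) F) = !![z, z * ϖ ^ n * v; z * ϖ ^ n, z + z * ϖ ^ n * u])
    {rm : ℕ → GL (Fin 2) F} (hrm : ∀ m, (rm m : Matrix (Fin 2) (Fin 2) F) = Matrix.diagonal ![1, ϖ ^ m]) (n : ℕ) :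
    (((rm n)⁻¹ * γ n * rm n : GL (Fin 2) F) : Matrix (Fin 2) (Fin 2) F) = !![z, z * v * ϖ ^ (2 * n); z, z + z * ϖ ^ n * u] := by
  have hn0 : ϖ ^ n ≠ 0 := pow_ne_zero _ hϖ.ne_zero
  rw [coe_inv_mul_torus_mul_of_coe_eq_diagonal u v z (z * ϖ ^ n) (hγ n) (hrm n) hn0]
  have h10 : z * ϖ ^ n * (ϖ ^ n)⁻¹ = z := by rw [mul_assoc, mul_inv_cancel₀ hn0, mul_one]
  have h01 : z * ϖ ^ n * v * ϖ ^ n = z * v * ϖ ^ (2 * n) := by ring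
  rw [h10, h01]

variable [TopologicalSpace F] [IsNonarchimedeanLocalField F]

include hϖ in
/-- **The deepest shell converges to the regular-unipotent direction**: `(r_n⁻¹ γ_n r_n, c) → (z·η, c)`, `η = (1 0; 1 1)`, because `(z·η)⁻¹ · r_n⁻¹ γ_n r_n =
(1, vϖ^{2n}; 0, 1 + ϖⁿu − vϖ^{2n}) ∈ K(ϖⁿ)` and the principal congruence subgroups shrink to `1` (★ `exists_congruenceGL_pow_subset`).
[cite: LabesseLanglands1979, §2 p. 8] [cite: Rogawski1990, §8.1 p. 116] -/
theorem tendsto_deepShell {u v : F} (hu : u ∈ 𝒪[F]) (hv : v ∈ 𝒪[F]) (z : Fˣ) (cu : GL (Fin 1) F)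
    {γ : ℕ → GL (Fin 2) F} (hγ : ∀ n, (γ n : Matrix (Fin 2) (Fin 2) F) = !![(z : F), z * ϖ ^ n * v; z * ϖ ^ n, z + z * ϖ ^ n * u])
    {rm : ℕ → GL (Fin 2) F} (hrm : ∀ m, (rm m : Matrix (Fin 2) (Fin 2) F) = Matrix.diagonal ![1, ϖ ^ m])
    {yS : GL (Fin 2) F} (hyS : (yS : Matrix (Fin 2) (Fin 2) F) = !![(z : F), 0; z, z]) :
    Tendsto (fun n => (((rm n)⁻¹ * γ n * rm n, cu) : GL (Fin 2) F × GL (Fin 1) F)) atTop (𝓝 (yS, cu)) := by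
  have hϖ1 := hϖ.valuation_lt_one
  -- `k_n := yS⁻¹ · r_n⁻¹ γ_n r_n ∈ K(ϖⁿ)` for `n ≥ 1`
  have hk : ∀ n, 1 ≤ n → yS⁻¹ * ((rm n)⁻¹ * γ n * rm n) ∈ congruenceGL 2 (valuation F ϖ ^ n) := fun n hn => by
    have hvn : valuation F ϖ ^ n < 1 := pow_lt_one₀ zero_le hϖ1 (by omega)
    have hmul : (yS : Matrix (Fin 2) (Fin 2) F) * !![1, v * ϖ ^ (2 * n); 0, 1 + ϖ ^ n * u - v * ϖ ^ (2 * n)] =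
        (((rm n)⁻¹ * γ n * rm n : GL (Fin 2) F) : Matrix (Fin 2) (Fin 2) F) := by
      rw [hyS, coe_deepShell hϖ (z : F) hγ hrm n, Matrix.mul_fin_two]
      ext i j
      fin_cases i <;> fin_cases j <;> simp <;> ring
    have hkM : ((yS⁻¹ * ((rm n)⁻¹ * γ n * rm n) : GL (Fin 2) F) : Matrix (Fin 2) (Fin 2) F) = !![1, v * ϖ ^ (2 * n); 0, 1 + ϖ ^ n * u - v * ϖ ^ (2 * n)] := by
      rw [Units.val_mul, ← hmul, ← Matrix.mul_assoc, Units.inv_mul, Matrix.one_mul]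
    have hsub : ((yS⁻¹ * ((rm n)⁻¹ * γ n * rm n) : GL (Fin 2) F) : Matrix (Fin 2) (Fin 2) F) - 1 = !![0, v * ϖ ^ (2 * n); 0, ϖ ^ n * u - v * ϖ ^ (2 * n)] := by
      rw [hkM]
      ext i j
      fin_cases i <;> fin_cases j
      · simp
      · simp
      · simp
      · simp; ring
    refine mem_congruenceGL_of_valBound_sub_one hvn fun i j => ?_
    rw [hsub]
    have hn' : valuation F (ϖ ^ n) = valuation F ϖ ^ n := map_pow _ _ _
    have h2n : valuation F (ϖ ^ (2 * n)) ≤ valuation F ϖ ^ n := by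
      rw [map_pow, pow_mul', sq]
      exact mul_le_of_le_one_left' (pow_le_one₀ zero_le hϖ1.le)
    have hvO := (Valuation.mem_integer_iff _ _).1 hv
    have huO := (Valuation.mem_integer_iff _ _).1 hu
    have h1 : valuation F (ϖ ^ n * u) ≤ valuation F ϖ ^ n := by
      rw [map_mul, hn']; exact mul_le_of_le_one_right' huO
    have h2 : valuation F (v * ϖ ^ (2 * n)) ≤ valuation F ϖ ^ n := by
      rw [map_mul]; exact (mul_le_of_le_one_left' hvO).trans h2n
    fin_cases i <;> fin_cases j
    · simp
    · simpa using h2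
    · simp
    · simpa using (Valuation.map_sub _ _ _).trans (max_le h1 h2)
  -- hence `k_n → 1` and `y_n = (yS, c) · (k_n, 1) → (yS, c)`
  have hk1 : Tendsto (fun n => yS⁻¹ * ((rm n)⁻¹ * γ n * rm n)) atTop (𝓝 1) := by
    rw [tendsto_atTop_nhds]
    intro U h1U hUo
    obtain ⟨m, hm, hmU⟩ := exists_congruenceGL_pow_subset hϖ (hUo.mem_nhds h1U)
    refine ⟨m, fun n hn => hmU ?_⟩
    exact congruenceGL_mono (pow_le_pow_right_of_le_one' hϖ.valuation_le_one hn) (hk n (hm.trans hn))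
  have hy : (fun n => (((rm n)⁻¹ * γ n * rm n, cu) : GL (Fin 2) F × GL (Fin 1) F)) =
      fun n => ((yS, cu) : GL (Fin 2) F × GL (Fin 1) F) * (yS⁻¹ * ((rm n)⁻¹ * γ n * rm n), 1) := by
    funext n
    simp only [Prod.mk_mul_mk, mul_inv_cancel_left, mul_one]
  rw [hy]
  have h2 : Tendsto (fun n => ((yS⁻¹ * ((rm n)⁻¹ * γ n * rm n), 1) : GL (Fin 2) F × GL (Fin 1) F)) atTop (𝓝 (1, 1)) :=
    hk1.prodMk_nhds tendsto_const_nhds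
  have h3 := h2.const_mul ((yS, cu) : GL (Fin 2) F × GL (Fin 1) F)
  rwa [Prod.mk_mul_mk, mul_one, mul_one] at h3

end Shell

/-! ## §2 The coherent-positivity criterion -/

section Criterion

variable [TopologicalSpace F] [IsNonarchimedeanLocalField F]
  [MeasurableSpace (GL (Fin 2) F × GL (Fin 1) F)] [BorelSpace (GL (Fin 2) F × GL (Fin 1) F)]
  [T2Space (GL (Fin 2) F × GL (Fin 1) F)] [LocallyCompactSpace (GL (Fin 2) F × GL (Fin 1) F)]
  [SecondCountableTopology (GL (Fin 2) F × GL (Fin 1) F)]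
  [∀ Γ : GL (Fin 2) F × GL (Fin 1) F, MeasurableSpace ((GL (Fin 2) F × GL (Fin 1) F) ⧸ Subgroup.centralizer ({Γ} : Set (GL (Fin 2) F × GL (Fin 1) F)))]
  [∀ Γ : GL (Fin 2) F × GL (Fin 1) F, BorelSpace ((GL (Fin 2) F × GL (Fin 1) F) ⧸ Subgroup.centralizer ({Γ} : Set (GL (Fin 2) F × GL (Fin 1) F)))]

include hϖ in
/-- **COHERENT POSITIVITY ⇒ NON-VANISHING ORBITAL INTEGRALS ALONG THE RAY.**  Let `ψ ∈ C_c^∞(P)` be PHASE-COHERENT on each class of the ray — for every `n`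
there is `c_n ≠ 0` with `ψ(g (γ_n, c) g⁻¹) ∈ c_n · ℝ_{≥0}` for all `g ∈ P` — and suppose `ψ` CHARGES the deepest shells: `ψ(k (r_n⁻¹γ_n r_n, c) k⁻¹) ≠ 0` for all
`k ∈ K_P` and `n ≥ N`.  Then for all `n ≫ 0` and every Haar `ρ` on `C_P((γ_n, c))` with `ρ(compactCore) = 1`: `O_{(γ_n,c)}^{ν∕ρ}(ψ) ≠ 0`.
Proof: the finite `K_P`-average `Ψ` of `ψ` (★ FILE M §1: `O(Ψ) = nK·O(ψ)`) unfolds as the shell sum `ν(K_P)·Σ_{r<R} q^r Ψ(X_r (γ_n,c) X_r⁻¹)` (★ FILE E), every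
summand lies in `c_n·ℝ_{≥0}`, and the `r = n` summand contains `ψ(k_i y_n k_i⁻¹) ≠ 0`.
[cite: LabesseLanglands1979, §2 pp. 8–9] [cite: HarishChandra1999AdmissibleDistributions, Thm. 3.1] [cite: Rogawski1990, §8.1 p. 116] -/
theorem eventually_orbitalIntegral_ne_zero_of_coherent {u v : F} (hu : u ∈ 𝒪[F]) (hu1 : valuation F u < 1) (hv1 : valuation F v = valuation F ϖ)
    (hdisc : u ^ 2 + 4 * v ≠ 0) (z : Fˣ) (cu : GL (Fin 1) F)
    {γτ : GL (Fin 2) F} (hγτ : (γτ : Matrix (Fin 2) (Fin 2) F) = !![0, v; 1, u])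
    {γ : ℕ → GL (Fin 2) F} (hγ : ∀ n, (γ n : Matrix (Fin 2) (Fin 2) F) = !![(z : F), z * ϖ ^ n * v; z * ϖ ^ n, z + z * ϖ ^ n * u])
    {rm : ℕ → GL (Fin 2) F} (hrm : ∀ m, (rm m : Matrix (Fin 2) (Fin 2) F) = Matrix.diagonal ![1, ϖ ^ m])
    (ν : Measure (GL (Fin 2) F × GL (Fin 1) F)) [ν.IsHaarMeasure] [ν.IsMulRightInvariant]
    {ψ : GL (Fin 2) F × GL (Fin 1) F → ℂ} (hψ : IsLocSmooth ψ)
    (hcoh : ∀ n, ∃ c : ℂ, c ≠ 0 ∧ ∀ g : GL (Fin 2) F × GL (Fin 1) F, ∃ t : ℝ, 0 ≤ t ∧ ψ (g * (γ n, cu) * g⁻¹) = c * t)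
    (hpos : ∃ N, ∀ n, N ≤ n → ∀ k ∈ (glInt 2 F).prod (glInt 1 F),
      ψ (k * (((rm n)⁻¹ * γ n * rm n, cu) : GL (Fin 2) F × GL (Fin 1) F) * k⁻¹) ≠ 0) :
    ∀ᶠ n in atTop, ∀ (ρ : Measure (Subgroup.centralizer ({((γ n, cu) : GL (Fin 2) F × GL (Fin 1) F)} : Set (GL (Fin 2) F × GL (Fin 1) F))))
        [ρ.IsHaarMeasure] [ρ.IsInvInvariant],
        ρ (compactCore (Subgroup.centralizer ({((γ n, cu) : GL (Fin 2) F × GL (Fin 1) F)} : Set (GL (Fin 2) F × GL (Fin 1) F)))) = 1 →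
        orbitalIntegral (γ n, cu) ψ (quotientMeasure (Subgroup.centralizer ({((γ n, cu) : GL (Fin 2) F × GL (Fin 1) F)} : Set (GL (Fin 2) F × GL (Fin 1) F))) ρ
          (isClosed_coe_centralizer_singleton (γ n, cu)) ν) ≠ 0 := by
  classical
  haveI : T2Space F := t2Space_of_isNonarchimedeanLocalField
  have h0 := hϖ.ne_zero
  have hv : v ∈ 𝒪[F] := by rw [Valuation.mem_integer_iff, hv1]; exact hϖ.valuation_le_one
  have hE := quadNormForm_integral_of_eisenstein hϖ hu hu1 hv1
  have hb : ∀ n : ℕ, (z : F) * ϖ ^ n ≠ 0 := fun n => mul_ne_zero z.ne_zero (pow_ne_zero _ h0)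
  have hCn : ∀ n, Subgroup.centralizer ({γ n} : Set (GL (Fin 2) F)) = Subgroup.centralizer ({γτ} : Set (GL (Fin 2) F)) := fun n =>
    centralizer_deep_eq_centralizer_companion (hb n) (hγ n) hγτ
  have hdisc' : ∀ n, (γ n : Matrix (Fin 2) (Fin 2) F).trace ^ 2 - 4 * (γ n : Matrix (Fin 2) (Fin 2) F).det ≠ 0 := fun n => by
    rw [trace_sq_sub_four_mul_det_regRep u v (z : F) (z * ϖ ^ n) (hγ n)]
    exact mul_ne_zero (pow_ne_zero _ (hb n)) hdisc
  have hOcl : ∀ n, IsClosed {g : GL (Fin 2) F × GL (Fin 1) F | ∃ y : GL (Fin 2) F × GL (Fin 1) F, y * (γ n, cu) * y⁻¹ = g} := fun n =>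
    isClosed_conjClass_pair (γ n) (hdisc' n) cu
  have hKc : IsCompact (((glInt 2 F).prod (glInt 1 F) : Subgroup (GL (Fin 2) F × GL (Fin 1) F)) : Set (GL (Fin 2) F × GL (Fin 1) F)) :=
    isCompact_prodGlInt
  have hKo : IsOpen (((glInt 2 F).prod (glInt 1 F) : Subgroup (GL (Fin 2) F × GL (Fin 1) F)) : Set (GL (Fin 2) F × GL (Fin 1) F)) := isOpen_prodGlInt
  have hw0 : ((ν ((glInt 2 F).prod (glInt 1 F))).toReal : ℂ) ≠ 0 := by
    rw [Complex.ofReal_ne_zero, ENNReal.toReal_ne_zero]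
    exact ⟨(hKo.measure_pos ν ⟨1, Subgroup.one_mem _⟩).ne', hKc.measure_lt_top.ne⟩
  have hXconj : ∀ n r, (((rm r)⁻¹, 1) : GL (Fin 2) F × GL (Fin 1) F) * (γ n, cu) * (((rm r)⁻¹, 1) : GL (Fin 2) F × GL (Fin 1) F)⁻¹ =
      ((rm r)⁻¹ * γ n * rm r, cu) := fun n r => by
    simp only [Prod.mk_mul_mk, Prod.inv_mk, inv_inv, one_mul, inv_one, mul_one]
  -- the finite `K_P`-average `Ψ` and its right-invariance level `m ≥ 1`
  obtain ⟨nK, kf, hnK, hkf, hinv⟩ :=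
    Literature.Topology.exists_finset_conj_sum_invariant_of_hasCompactSupport (K := (glInt 2 F).prod (glInt 1 F)) hKc hψ.1 hψ.2
  obtain ⟨Ψ, hΨ⟩ : ∃ Ψ : GL (Fin 2) F × GL (Fin 1) F → ℂ, Ψ = fun x => ∑ i, ψ (kf i * x * (kf i)⁻¹) := ⟨_, rfl⟩
  have hΨs : IsLocSmooth Ψ := by
    rw [hΨ]; exact ⟨Literature.Topology.isLocallyConstant_sum_conj hψ.1 kf, Literature.Topology.hasCompactSupport_sum_conj hψ.2 kf⟩
  have hΨK : ∀ k ∈ (glInt 2 F).prod (glInt 1 F), ∀ y, Ψ (k * y * k⁻¹) = Ψ y := fun k hk y => by rw [hΨ]; exact hinv k hk y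
  have hnK0 : (nK : ℂ) ≠ 0 := by exact_mod_cast hnK.ne'
  obtain ⟨V, hV, hVΨ⟩ := Literature.Topology.exists_nhds_one_forall_mul_eq_of_hasCompactSupport hΨs.1 hΨs.2
  have hU : (fun g : GL (Fin 2) F => ((g, 1) : GL (Fin 2) F × GL (Fin 1) F)) ⁻¹' V ∈ 𝓝 (1 : GL (Fin 2) F) :=
    (continuous_id.prodMk continuous_const).continuousAt.preimage_mem_nhds (by exact hV)
  obtain ⟨m, hm, hmU⟩ := exists_congruenceGL_pow_subset hϖ hU
  have hright : ∀ k ∈ congruenceGL 2 (valuation F ϖ ^ m), ∀ x : GL (Fin 2) F, Ψ (x * k, cu) = Ψ (x, cu) := fun k hk x => by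
    have := hVΨ (x, cu) (k, 1) (hmU hk)
    simpa only [Prod.mk_mul_mk, mul_one] using this
  obtain ⟨N, hN⟩ := hpos
  refine Filter.eventually_atTop.2 ⟨max m N, fun n hn => ?_⟩
  intro ρ _ _ hρ
  have hmn : m ≤ n := (le_max_left _ _).trans hn
  have hNn : N ≤ n := (le_max_right _ _).trans hn
  -- a shell bound `R > n` at depth `n`, the shell sum of `Ψ`, and `O(Ψ) = nK · O(ψ)`
  obtain ⟨R₀, hR₀⟩ := exists_forall_le_apply_shellConj_eq_zero hϖ hu hv hE hγτ (hCn n) cu hrm (hOcl n) hΨs.2 hΨK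
  have hR : ∀ r, max R₀ (n + 1) ≤ r →
      Ψ ((((rm r)⁻¹, 1) : GL (Fin 2) F × GL (Fin 1) F) * (γ n, cu) * (((rm r)⁻¹, 1) : GL (Fin 2) F × GL (Fin 1) F)⁻¹) = 0 :=
    fun r hr => hR₀ r ((le_max_left _ _).trans hr)
  have hshell := orbitalIntegral_eq_mul_sum_shell hϖ hu hu1 hv1 hγτ (hCn n) cu hrm (hOcl n) hΨs.continuous hΨs.2 hΨK ρ hρ ν hR
  have havg : orbitalIntegral (γ n, cu) Ψ (quotientMeasure (Subgroup.centralizer ({((γ n, cu) : GL (Fin 2) F × GL (Fin 1) F)} : Set (GL (Fin 2) F × GL (Fin 1) F))) ρ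
      (isClosed_coe_centralizer_singleton (γ n, cu)) ν) =
      (nK : ℂ) * orbitalIntegral (γ n, cu) ψ (quotientMeasure (Subgroup.centralizer ({((γ n, cu) : GL (Fin 2) F × GL (Fin 1) F)} : Set (GL (Fin 2) F × GL (Fin 1) F))) ρ
      (isClosed_coe_centralizer_singleton (γ n, cu)) ν) := by
    rw [hΨ]; exact orbitalIntegral_sum_conj_eq (γ n, cu) (hOcl n) hψ.continuous hψ.2 kf ρ ν
  -- phase coherence on the class of `(γ_n, c)`
  obtain ⟨c, hc0, hcoh'⟩ := hcoh n
  have hterm : ∀ r (i : Fin nK), ∃ t : ℝ, 0 ≤ t ∧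
      ψ (kf i * ((((rm r)⁻¹, 1) : GL (Fin 2) F × GL (Fin 1) F) * (γ n, cu) * (((rm r)⁻¹, 1) : GL (Fin 2) F × GL (Fin 1) F)⁻¹) * (kf i)⁻¹) = c * t :=
    fun r i => by
      obtain ⟨t, ht, h⟩ := hcoh' (kf i * (((rm r)⁻¹, 1) : GL (Fin 2) F × GL (Fin 1) F))
      refine ⟨t, ht, ?_⟩
      rw [← h]
      congr 1
      group
  choose t ht0 hteq using hterm
  have hsum : ∑ r ∈ Finset.range (max R₀ (n + 1)), ((Nat.card (IsLocalRing.ResidueField 𝒪[F]) : ℂ) ^ r) *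
        Ψ ((((rm r)⁻¹, 1) : GL (Fin 2) F × GL (Fin 1) F) * (γ n, cu) * (((rm r)⁻¹, 1) : GL (Fin 2) F × GL (Fin 1) F)⁻¹) =
      (c : ℂ) * ((∑ r ∈ Finset.range (max R₀ (n + 1)), ((Nat.card (IsLocalRing.ResidueField 𝒪[F]) : ℝ) ^ r) * ∑ i, t r i : ℝ) : ℂ) := by
    rw [Complex.ofReal_sum, Finset.mul_sum]
    refine Finset.sum_congr rfl fun r _ => ?_
    rw [hΨ]
    simp only [hteq]
    rw [← Finset.mul_sum, Complex.ofReal_mul, Complex.ofReal_pow, Complex.ofReal_natCast, Complex.ofReal_sum]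
    ring
  -- the real double sum is positive: its `r = n` summand contains `ψ(k_i y_n k_i⁻¹) ≠ 0`
  have hq0 : (0 : ℝ) < (Nat.card (IsLocalRing.ResidueField 𝒪[F]) : ℝ) := by exact_mod_cast Nat.card_pos
  have hpos' : 0 < ∑ r ∈ Finset.range (max R₀ (n + 1)), ((Nat.card (IsLocalRing.ResidueField 𝒪[F]) : ℝ) ^ r) * ∑ i, t r i := by
    have hi : ∃ i : Fin nK, 0 < t n i := by
      refine ⟨⟨0, hnK⟩, lt_of_le_of_ne (ht0 _ _) fun h => ?_⟩
      have hne := hN n hNn (kf ⟨0, hnK⟩) (hkf _)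
      rw [← hXconj n n, hteq, ← h, Complex.ofReal_zero, mul_zero] at hne
      exact hne rfl
    obtain ⟨i₀, hi₀⟩ := hi
    have hle : ((Nat.card (IsLocalRing.ResidueField 𝒪[F]) : ℝ) ^ n) * ∑ i, t n i ≤
        ∑ r ∈ Finset.range (max R₀ (n + 1)), ((Nat.card (IsLocalRing.ResidueField 𝒪[F]) : ℝ) ^ r) * ∑ i, t r i :=
      Finset.single_le_sum (f := fun r => ((Nat.card (IsLocalRing.ResidueField 𝒪[F]) : ℝ) ^ r) * ∑ i, t r i)
        (fun r _ => mul_nonneg (pow_nonneg hq0.le _) (Finset.sum_nonneg fun i _ => ht0 r i))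
        (Finset.mem_range.2 ((Nat.lt_succ_self n).trans_le (le_max_right _ _)))
    refine lt_of_lt_of_le (mul_pos (pow_pos hq0 _) ?_) hle
    exact lt_of_lt_of_le hi₀ (Finset.single_le_sum (f := fun i => t n i) (fun i _ => ht0 n i) (Finset.mem_univ i₀))
  -- conclude
  intro hO
  rw [hO, mul_zero] at havg
  rw [havg, hsum] at hshell
  have := hshell.symm
  rw [mul_eq_zero, mul_eq_zero] at this
  rcases this with h | h | h
  · exact hw0 h
  · exact hc0 h
  · exact hpos'.ne' (Complex.ofReal_eq_zero.1 h)

end Criterion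

end Summit.HodgeConjecture.HodgeConjecture.Cruxes.H413.K2E3GLTwoRamifiedRayUnipotentShell

end
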